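import Mathlib.RingTheory.MvPolynomial.Basic
import Mathlib.RingTheory.Ideal.Operations
import HarnessLib

/-!
# Monomial cover records (the `hcov` binder) [OURS · L1 W4.5a]

One record of the toric-certificate fan supplies exponent vectors `a m b r` and a
multiplier `K ≥ 1` with `K • a = m + (K - 1) • b + r` and `b ∈ A`; the consumer
(`CICertificates.ciCertificates`, binder `hcov`) wants, for each `a ∈ A`, a chart `c` and
a witness `y ∈ (Ideal.span (monomial '' A)) ^ (K - 1)` with
`(monomial a 1) ^ K = monomial (m c) 1 * y`.
The witness is `y := (monomial b 1) ^ (K - 1) * monomial r 1`.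

* `monomialCoverRecord` — the witness for one record;
* `monomialCoverRecord_one` — the `K = 1` record (`a = m + r`, no `b` needed);
* `hcov_of_record` / `hcov_of_record_one` — the same, packaged in the literal `∃ c K, 1 ≤ K ∧ ∃ y ∈ _, _`
  shape of the `hcov` binder, so that a generated data module closes each `a ∈ A` by one `exact`.
-/

set_option linter.dupNamespace false -- mandated namespace of this single-conjunct summit

namespace Summit.ResolutionOfSingularities.ResolutionOfSingularities.Theorems.FInjectiveMacaulayfication.MonomialCoverRecord

open MvPolynomial

/-- [OURS · L1 W4.5a] The `hcov` witness from one cover record: if `b ∈ A` and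
`K • a = m + (K - 1) • b + r`, then `(monomial a 1) ^ K = monomial m 1 * y` for
`y = (monomial b 1) ^ (K - 1) * monomial r 1`, which lies in the `(K - 1)`-st power of the
monomial ideal spanned by `A`. (`1 ≤ K` is not needed for this identity; it is kept by the
packaged forms below because the consumer's binder carries it.) -/
theorem monomialCoverRecord (k : Type*) [CommSemiring k] {n : ℕ} (A : Finset (Fin n →₀ ℕ))
    (a m b r : Fin n →₀ ℕ) (K : ℕ) (hb : b ∈ A)
    (hrec : K • a = m + (K - 1) • b + r) :
    ∃ y ∈ (Ideal.span ((fun b : Fin n →₀ ℕ => (monomial b (1 : k) : MvPolynomial (Fin n) k)) ''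
        (A : Set (Fin n →₀ ℕ)))) ^ (K - 1),
      (monomial a (1 : k) : MvPolynomial (Fin n) k) ^ K = monomial m 1 * y := by
  refine ⟨(monomial b (1 : k)) ^ (K - 1) * monomial r 1, ?_, ?_⟩
  · refine Ideal.mul_mem_right _ _ (Ideal.pow_mem_pow (Ideal.subset_span ?_) _)
    exact ⟨b, by exact_mod_cast hb, rfl⟩
  · rw [monomial_pow, monomial_pow, monomial_mul, monomial_mul, one_pow, one_pow, mul_one,
      mul_one, hrec, add_assoc]

/-- [OURS · L1 W4.5a] The `K = 1` cover record: if `a = m + r` then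
`(monomial a 1) ^ 1 = monomial m 1 * monomial r 1`, and the witness lies in the `0`-th power
(`= ⊤`) of the monomial ideal. -/
theorem monomialCoverRecord_one (k : Type*) [CommSemiring k] {n : ℕ} (A : Finset (Fin n →₀ ℕ))
    (a m r : Fin n →₀ ℕ) (hrec : a = m + r) :
    ∃ y ∈ (Ideal.span ((fun b : Fin n →₀ ℕ => (monomial b (1 : k) : MvPolynomial (Fin n) k)) ''
        (A : Set (Fin n →₀ ℕ)))) ^ (1 - 1),
      (monomial a (1 : k) : MvPolynomial (Fin n) k) ^ 1 = monomial m 1 * y := by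
  refine ⟨monomial r 1, ?_, ?_⟩
  · simp only [Nat.sub_self, pow_zero, Ideal.one_eq_top, Submodule.mem_top]
  · rw [pow_one, monomial_mul, mul_one, hrec]

/-- [OURS · L1 W4.5a] One record in the literal shape of the `hcov` binder of
`CICertificates.ciCertificates`: given the chart index `c`, the multiplier `K ≥ 1`, a member
`b ∈ A` and the exponent bookkeeping `K • a = m c + (K - 1) • b + r`, produce
`∃ c K, 1 ≤ K ∧ ∃ y ∈ (Ideal.span (monomial '' A)) ^ (K - 1), (monomial a 1) ^ K = monomial (m c) 1 * y`. -/
theorem hcov_of_record (k : Type*) [CommSemiring k] {n : ℕ} (A : Finset (Fin n →₀ ℕ))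
    {t : ℕ} (m : Fin t → (Fin n →₀ ℕ)) (a : Fin n →₀ ℕ) (c : Fin t) (K : ℕ) (hK : 1 ≤ K)
    (b r : Fin n →₀ ℕ) (hb : b ∈ A) (hrec : K • a = m c + (K - 1) • b + r) :
    ∃ (c : Fin t) (K : ℕ), 1 ≤ K ∧
      ∃ y ∈ (Ideal.span ((fun b : Fin n →₀ ℕ => (monomial b (1 : k) : MvPolynomial (Fin n) k)) ''
          (A : Set (Fin n →₀ ℕ)))) ^ (K - 1),
        (monomial a (1 : k) : MvPolynomial (Fin n) k) ^ K = monomial (m c) 1 * y :=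
  ⟨c, K, hK, monomialCoverRecord k A a (m c) b r K hb hrec⟩

/-- [OURS · L1 W4.5a] The `K = 1` record in the literal shape of the `hcov` binder:
`a = m c + r` gives `∃ c K, 1 ≤ K ∧ ∃ y ∈ _, (monomial a 1) ^ K = monomial (m c) 1 * y`
with `K = 1`, `y = monomial r 1`. -/
theorem hcov_of_record_one (k : Type*) [CommSemiring k] {n : ℕ} (A : Finset (Fin n →₀ ℕ))
    {t : ℕ} (m : Fin t → (Fin n →₀ ℕ)) (a : Fin n →₀ ℕ) (c : Fin t) (r : Fin n →₀ ℕ)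
    (hrec : a = m c + r) :
    ∃ (c : Fin t) (K : ℕ), 1 ≤ K ∧
      ∃ y ∈ (Ideal.span ((fun b : Fin n →₀ ℕ => (monomial b (1 : k) : MvPolynomial (Fin n) k)) ''
          (A : Set (Fin n →₀ ℕ)))) ^ (K - 1),
        (monomial a (1 : k) : MvPolynomial (Fin n) k) ^ K = monomial (m c) 1 * y :=
  ⟨c, 1, le_rfl, monomialCoverRecord_one k A a (m c) r hrec⟩

end Summit.ResolutionOfSingularities.ResolutionOfSingularities.Theorems.FInjectiveMacaulayfication.MonomialCoverRecord
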